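import Literature.Analysis.SpecialFunctions.DigammaStirlingSeries
import Literature.Analysis.SpecialFunctions.DigammaStirlingSecondOrder
import Literature.Analysis.SpecialFunctions.GammaStirlingUniform
import Literature.Analysis.SpecialFunctions.GammaRatioStirling
import Literature.NumberTheory.LFunctions.RiemannSiegelStirling
import HarnessLib

/-!
# The complex Stirling formula with an explicit error in the upper half-plane

Topic `Literature/Analysis/SpecialFunctions` (companion of `GammaStirlingUniform.lean` — the uniform
first-order Stirling formula for the MODULUS `log ‖Γ(w)‖` on `Re w > 0` —, of
`DigammaStirlingSeries.lean` — Stirling's series for `ψ` with explicit remainders on `Re w > 0` — and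
of `Literature/NumberTheory/LFunctions/RiemannSiegelStirling.lean` — the vertical expansion of
`arg Γ(σ + iτ)` with its constant `c(σ)`, `c(½) = 0`). Everything here is PROVED; there are two
auxiliary definitions (`binetDeriv`, `stirlingExp`) and no named facts.

The tree so far had no Stirling formula for the complex `Γ`-function ITSELF (modulus and argument
together) valid for arbitrary real part. This file proves, for every `z` with `Im z > 0`,

* `exists_Gamma_eq_exp_stirlingExp` — `Γ(z) = √(2π) · exp((z − ½) Log z − z + 1/(12z) + E)` with
  `|E| ≤ (π+1)/(16π (Im z)²)` (`< 0.0824/(Im z)²`);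
* `exists_Gamma_eq_exp_stirling` — `Γ(z) = √(2π) · exp((z − ½) Log z − z + E)` with
  `|E| ≤ 1/(12|z|) + (π+1)/(16π (Im z)²)`;
* `exists_Gamma_eq_exp_stirling_of_one_lt_im` — for `Im z > 1` the packaging
  `|E| ≤ 1/(12 (Im z − 1))`, the shape of Polymath 15, Lemma 5.1 (v)
  (`Γ(z) = √(2π) exp((z − ½) log z − z + O_≤(1/(12(|z| − 0.33))))` for `|Im z| ≥ 1 ∨ Re z ≥ 1`,
  there quoted from Boyd's sharper bounds), which is the Stirling input of the effective
  Riemann–Siegel approximation of the heat-flowed `ξ`-function (Polymath 15, Prop. 6.1/6.3; tree: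
  `Literature.NumberTheory.LFunctions.Polymath15.effective_approximation`);

and on the way

* `tendsto_log_sub_sum_inv_digamma_of_im_ne_zero` — Gauss's formula
  `ψ(w) = lim (log n − Σ_{j≤n} 1/(w+j))` for `Im w ≠ 0` (the tree had it for `Re w > 0`);
* `norm_digamma_sub_stirling_le_of_im_pos` — `‖ψ(w) − (Log w − 1/(2w) − 1/(12w²))‖ ≤ (π+1)/(8π (Im w)³)`
  for `Im w > 0`, uniformly in `Re w` (Euler–Maclaurin of order one, the remainder
  `∫ B̄₃(x)(w+x)^{−4} dx` bounded through `∫ dx/((Re w + x)² + (Im w)²)² ≤ (π+1)/(2 (Im w)³)`,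
  `integral_inv_sq_add_sq_sq_le`);
* `Gamma_eq_mul_exp_integral_digamma_seg`, `Gamma_mul_exp_neg_stirlingExp_seg` /
  `…_vertical` — transport of `Γ` and of `Q = Γ e^{−S}`, `S = stirlingExp`, along segments of the
  slit plane: `Q(w₀ + d) = Q(w₀) exp(∫_{[w₀, w₀+d]} μ')`, `μ' = binetDeriv = ψ − S'`;
* `tendsto_Gamma_mul_exp_neg_stirlingExp_half_line` — the normalisation `Q(½ + iτ) → √(2π)`:
  modulus by `GammaStirling.abs_log_norm_Gamma_sub_le`, argument by
  `abs_argGammaVert_sub_stirling_le` and `c(½) = 0` (`stirlingArgConst_one_half`).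

## Proof of the main theorem

For `Im z = u > 0`, `Q(z + iY) = Q(z) exp(i ∫_0^Y μ'(z + iy) dy)` with
`∫_0^∞ ‖μ'(z + iy)‖ dy ≤ ∫_0^∞ (π+1)/(8π (u + y)³) dy = (π+1)/(16π u²)`, so `Q(z + iY) → Q(z) e^{iL}`,
`|L| ≤ (π+1)/(16π u²)`; on the other hand `Q(z + iY) = Q(½ + i(u+Y)) · exp(∫_{horizontal} μ')` with the
horizontal segment at height `u + Y`, where `‖μ'‖ ≤ (π+1)/(8π (u+Y)³) → 0`, so `Q(z + iY) → √(2π)`.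
Hence `Q(z) = √(2π) e^{−iL}`. (Binet's and Stieltjes' classical treatments bound the remainder by
`1/(12|z|) sec²(½ arg z)`, which degenerates as `Re z → −∞`; measuring the error by `Im z` is what the
application needs, since there the real part is unrestricted.)

## References

* E. T. Whittaker, G. N. Watson, *A Course of Modern Analysis*, 4th ed. (1927), §12.33 (Binet's
  second expression for `log Γ`, Stirling's series), §13.6.
* G. E. Andrews, R. Askey, R. Roy, *Special Functions* (1999), Thm. 1.2.5 (Gauss), Cor. 1.4.5
  (Stirling for `ψ`). [AndrewsAskeyRoy1999]
* D. H. J. Polymath, *Effective approximation of heat flow evolution of the Riemann ξ function, and a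
  new upper bound for the de Bruijn–Newman constant*, Res. Math. Sci. 6 (2019), Lemma 5.1 (v).
  [Polymath2019]
-/

noncomputable section

open Complex Real Set Filter Topology MeasureTheory intervalIntegral

namespace Literature.Analysis.SpecialFunctions.GammaStirling

open Literature.NumberTheory.LFunctions (bernoulliPer abs_bernoulliPer_odd_le)
open Literature.Barriers.RiemannHypothesis.Lemma2 (eulerMaclaurin_family)
open Literature.Analysis.SpecialFunctions.Complex (tendsto_log_sub_sum_inv_digamma
  norm_add_ofReal_sq)

/-! ### Gauss's formula off the real axis -/

/-- **Gauss's formula** `ψ(w) = lim_{n→∞} (log n − Σ_{j=0}^{n} 1/(w+j))` for `Im w ≠ 0` (from the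
right half-plane case `tendsto_log_sub_sum_inv_digamma` and the recurrence `ψ(w+1) = ψ(w) + 1/w`,
by induction on the number of unit shifts needed to reach `Re > 0`).
[cite: AndrewsAskeyRoy1999, Thm 1.2.5] -/
theorem tendsto_log_sub_sum_inv_digamma_of_im_ne_zero {w : ℂ} (hw : w.im ≠ 0) :
    Tendsto (fun n : ℕ ↦ (Real.log n : ℂ) - ∑ j ∈ Finset.range (n + 1), 1 / (w + j)) atTop
      (𝓝 (digamma w)) := by
  suffices H : ∀ m : ℕ, ∀ w : ℂ, w.im ≠ 0 → 0 < w.re + m →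
      Tendsto (fun n : ℕ ↦ (Real.log n : ℂ) - ∑ j ∈ Finset.range (n + 1), 1 / (w + j)) atTop
        (𝓝 (digamma w)) by
    obtain ⟨m, hm⟩ := exists_nat_gt (-w.re)
    exact H m w hw (by linarith)
  intro m
  induction m with
  | zero =>
    intro w _ hre
    exact tendsto_log_sub_sum_inv_digamma (by simpa using hre)
  | succ m ih =>
    intro w hw hre
    have hw1 : (w + 1).im ≠ 0 := by simpa using hw
    have hre1 : 0 < (w + 1).re + m := by
      simp only [add_re, one_re]
      push_cast at hre
      linarith
    have h1 := ih (w + 1) hw1 hre1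
    have hne : ∀ k : ℕ, w ≠ -k := by
      intro k h
      have := congrArg Complex.im h
      simp at this
      exact hw this
    have hrec : digamma w = digamma (w + 1) + 0 - w⁻¹ := by
      rw [Complex.digamma_apply_add_one w hne]; ring
    have hlog : Tendsto (fun n : ℕ ↦ ((Real.log ((n : ℝ) + 1) : ℝ) : ℂ) - (Real.log n : ℂ))
        atTop (𝓝 0) := by
      have := (Complex.continuous_ofReal.tendsto 0).comp Real.tendsto_log_nat_add_one_sub_log
      rw [Complex.ofReal_zero] at this
      refine this.congr fun n ↦ ?_
      simp only [Function.comp_apply, Complex.ofReal_sub]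
    have h2 := (h1.add hlog).sub (tendsto_const_nhds (x := w⁻¹))
    rw [← hrec] at h2
    have h3 : ∀ n : ℕ, (Real.log (n + 1 : ℕ) : ℂ) - ∑ j ∈ Finset.range (n + 1 + 1), 1 / (w + j) =
        ((Real.log n : ℂ) - ∑ j ∈ Finset.range (n + 1), 1 / (w + 1 + j)) +
          (((Real.log ((n : ℝ) + 1) : ℝ) : ℂ) - (Real.log n : ℂ)) - w⁻¹ := by
      intro n
      have hs : ∑ j ∈ Finset.range (n + 1 + 1), 1 / (w + (j : ℂ)) =
          ∑ j ∈ Finset.range (n + 1), 1 / (w + 1 + (j : ℂ)) + w⁻¹ := by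
        rw [Finset.sum_range_succ']
        congr 1
        · refine Finset.sum_congr rfl fun j _ ↦ ?_
          push_cast
          ring
        · simp
      rw [hs]
      push_cast
      ring
    refine (tendsto_add_atTop_iff_nat 1).mp ?_
    simp only [h3]
    exact h2

/-! ### Euler–Maclaurin of order one for `Σ 1/(w+j)`, `Im w ≠ 0` -/

/-- The family `g_j(x) = (−1)^j j! (w+x)^{-(j+1)}` is a derivative family on `ℝ` (`Im w ≠ 0`).
[folklore] -/
private lemma hasDerivAt_gFam {w : ℂ} (hw : w.im ≠ 0) (j : ℕ) (x : ℝ) :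
    HasDerivAt (fun y : ℝ ↦ (-1 : ℂ) ^ j * (j.factorial : ℂ) * (w + y) ^ (-(j + 1 : ℤ)))
      ((-1 : ℂ) ^ (j + 1) * ((j + 1).factorial : ℂ) * (w + x) ^ (-(j + 1 + 1 : ℤ))) x := by
  have hne : w + (x : ℂ) ≠ 0 := Literature.NumberTheory.LFunctions.Complex.add_ofReal_ne_zero hw x
  have h1 := hasDerivAt_zpow (-(j + 1 : ℤ)) (w + (x : ℂ)) (Or.inl hne)
  have h2 : HasDerivAt (fun z : ℂ ↦ w + z) 1 (x : ℂ) := (hasDerivAt_id _).const_add w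
  have h3 := (h1.comp (x : ℂ) h2).comp_ofReal
  have h4 := h3.const_mul ((-1 : ℂ) ^ j * (j.factorial : ℂ))
  simp only [Function.comp_def, mul_one] at h4
  refine h4.congr_deriv ?_
  have e : (-(j + 1 : ℤ) - 1 : ℤ) = -(j + 1 + 1 : ℤ) := by ring
  rw [e, Nat.factorial_succ]
  push_cast
  ring

/-- `∫_0^n dx/(w+x) = Log(w+n) − Log w` for `Im w ≠ 0`. [folklore] -/
private lemma integral_gFam_zero {w : ℂ} (hw : w.im ≠ 0) (n : ℕ) :
    ∫ x in (0 : ℝ)..n, (-1 : ℂ) ^ 0 * ((0 : ℕ).factorial : ℂ) * (w + x) ^ (-(0 + 1 : ℤ))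
      = Complex.log (w + n) - Complex.log w := by
  have hderiv : ∀ x ∈ uIcc (0 : ℝ) n, HasDerivAt (fun y : ℝ ↦ Complex.log (w + y)) ((w + x)⁻¹) x := by
    intro x _
    have hslit : w + (x : ℂ) ∈ slitPlane := Or.inr (by simpa using hw)
    have h2 : HasDerivAt (fun y : ℝ ↦ w + (y : ℂ)) 1 x := by
      simpa using ((hasDerivAt_id x).ofReal_comp).const_add w
    have h3 := h2.clog_real hslit
    simpa [one_div] using h3
  have hcont : ContinuousOn (fun x : ℝ ↦ (w + x)⁻¹) (uIcc (0 : ℝ) n) :=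
    ContinuousOn.inv₀ (by fun_prop) fun x _ ↦ Literature.NumberTheory.LFunctions.Complex.add_ofReal_ne_zero hw x
  have := integral_eq_sub_of_hasDerivAt hderiv (hcont.intervalIntegrable)
  simp only [pow_zero, Nat.factorial_zero, Nat.cast_one, one_mul, zero_add] at this ⊢
  rw [show (-(1 : ℤ)) = -1 from rfl]
  simp_rw [zpow_neg_one]
  simpa using this

/-- `∫_0^n dx/((a+x)² + b²)² ≤ (π + 1)/(2b³)` for `b > 0` (primitive
`(arctan((a+x)/b) + b(a+x)/((a+x)²+b²))/(2b³)`, bounded by `(π/2 + 1/2)/(2b³)`). [folklore] -/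
private theorem integral_inv_sq_add_sq_sq_le {a b : ℝ} (hb : 0 < b) (n : ℕ) :
    ∫ x in (0 : ℝ)..n, (((a + x) ^ 2 + b ^ 2) ^ 2)⁻¹ ≤ (π + 1) / (2 * b ^ 3) := by
  set G : ℝ → ℝ := fun x ↦
    (Real.arctan ((a + x) / b) + b * (a + x) / ((a + x) ^ 2 + b ^ 2)) / (2 * b ^ 3) with hG
  have hpos : ∀ x : ℝ, 0 < (a + x) ^ 2 + b ^ 2 := fun x ↦ by positivity
  have hderiv : ∀ x : ℝ, HasDerivAt G ((((a + x) ^ 2 + b ^ 2) ^ 2)⁻¹) x := by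
    intro x
    have h1 : HasDerivAt (fun x : ℝ ↦ (a + x) / b) (1 / b) x := by
      have := ((hasDerivAt_id x).const_add a).div_const b
      simpa using this
    have h2 : HasDerivAt (fun x : ℝ ↦ Real.arctan ((a + x) / b))
        (1 / (1 + ((a + x) / b) ^ 2) * (1 / b)) x :=
      (Real.hasDerivAt_arctan _).comp x h1
    have h3 : HasDerivAt (fun x : ℝ ↦ b * (a + x)) b x := by
      simpa using ((hasDerivAt_id x).const_add a).const_mul b
    have h4 : HasDerivAt (fun x : ℝ ↦ (a + x) ^ 2 + b ^ 2) (2 * (a + x)) x := by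
      have := (((hasDerivAt_id x).const_add a).pow 2).add_const (b ^ 2)
      simpa using this
    have h5 := h3.div h4 (hpos x).ne'
    have h6 := (h2.add h5).div_const (2 * b ^ 3)
    refine h6.congr_deriv ?_
    have hb0 : b ≠ 0 := hb.ne'
    have hq : (a + x) ^ 2 + b ^ 2 ≠ 0 := (hpos x).ne'
    have hq' : 1 + ((a + x) / b) ^ 2 ≠ 0 := by positivity
    field_simp
    ring
  have hGb : ∀ x : ℝ, |G x| ≤ (π / 2 + 1 / 2) / (2 * b ^ 3) := by
    intro x
    rw [hG, abs_div, abs_of_pos (by positivity : (0 : ℝ) < 2 * b ^ 3)]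
    refine div_le_div_of_nonneg_right ((abs_add_le _ _).trans (add_le_add ?_ ?_)) (by positivity)
    · exact (abs_le.2 ⟨(Real.neg_pi_div_two_lt_arctan _).le, (Real.arctan_lt_pi_div_two _).le⟩)
    · rw [abs_div, abs_of_pos (hpos x), div_le_iff₀ (hpos x), abs_mul, abs_of_pos hb]
      nlinarith [sq_abs (a + x), sq_nonneg (|a + x| - b), abs_nonneg (a + x)]
  have hcont : Continuous fun x : ℝ ↦ (((a + x) ^ 2 + b ^ 2) ^ 2)⁻¹ :=
    Continuous.inv₀ (by fun_prop) fun x ↦ (pow_pos (hpos x) 2).ne'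
  calc ∫ x in (0 : ℝ)..n, (((a + x) ^ 2 + b ^ 2) ^ 2)⁻¹ = G n - G 0 :=
        integral_eq_sub_of_hasDerivAt (fun x _ ↦ hderiv x) (hcont.intervalIntegrable _ _)
    _ ≤ |G n| + |G 0| := by
        have h1 := le_abs_self (G n)
        have h2 := neg_abs_le (G 0)
        linarith
    _ ≤ 2 * ((π / 2 + 1 / 2) / (2 * b ^ 3)) := by linarith [hGb n, hGb 0]
    _ = (π + 1) / (2 * b ^ 3) := by ring

/-- `|B̄₃(x)| ≤ 1/(4π)` (the case `ν = 1` of `abs_bernoulliPer_odd_le`). [folklore] -/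
private theorem abs_bernoulliPer_three_le (x : ℝ) : |bernoulliPer 3 x| ≤ 1 / (4 * π) := by
  have h := abs_bernoulliPer_odd_le (ν := 1) one_ne_zero x
  have e : Real.pi ^ 2 / 3 * ((2 * 1 + 1).factorial : ℝ) / (2 * Real.pi) ^ (2 * 1 + 1) =
      1 / (4 * π) := by
    have hπ : Real.pi ≠ 0 := Real.pi_ne_zero
    norm_num [Nat.factorial]
    field_simp
    ring
  rw [e] at h
  exact h

/-- `‖(w + x)^{−4}‖ = ((Re w + x)² + (Im w)²)^{−2}`. [folklore] -/
private lemma norm_zpow_neg_four {w : ℂ} (x : ℝ) :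
    ‖(w + x) ^ (-(4 : ℤ))‖ = (((w.re + x) ^ 2 + w.im ^ 2) ^ 2)⁻¹ := by
  rw [zpow_neg, norm_inv, show (4 : ℤ) = ((4 : ℕ) : ℤ) from rfl, zpow_natCast, norm_pow,
    show (4 : ℕ) = 2 * 2 from rfl, pow_mul, norm_add_ofReal_sq]

/-- Remainder bound, uniformly in `n`: `‖∫_0^n B̄₃(x) (w+x)^{−4} dx‖ ≤ (π+1)/(8π (Im w)³)` for
`Im w > 0`. [folklore] -/
private lemma norm_integral_bernoulliPer_three_le {w : ℂ} (hw : 0 < w.im) (n : ℕ) :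
    ‖∫ x in (0 : ℝ)..n, (bernoulliPer 3 x : ℂ) * (w + x) ^ (-(4 : ℤ))‖ ≤
      (π + 1) / (8 * π * w.im ^ 3) := by
  have hpos : ∀ x : ℝ, 0 < (w.re + x) ^ 2 + w.im ^ 2 := fun x ↦ by positivity
  have hpt : ∀ᵐ x : ℝ, x ∈ Ioc (0 : ℝ) n →
      ‖(bernoulliPer 3 x : ℂ) * (w + x) ^ (-(4 : ℤ))‖ ≤
        1 / (4 * π) * (((w.re + x) ^ 2 + w.im ^ 2) ^ 2)⁻¹ := by
    refine ae_of_all _ fun x _ ↦ ?_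
    rw [norm_mul, Complex.norm_real, Real.norm_eq_abs, norm_zpow_neg_four]
    exact mul_le_mul_of_nonneg_right (abs_bernoulliPer_three_le x) (by positivity)
  have hcont : Continuous fun x : ℝ ↦ 1 / (4 * π) * (((w.re + x) ^ 2 + w.im ^ 2) ^ 2)⁻¹ :=
    continuous_const.mul (Continuous.inv₀ (by fun_prop) fun x ↦ (pow_pos (hpos x) 2).ne')
  calc ‖∫ x in (0 : ℝ)..n, (bernoulliPer 3 x : ℂ) * (w + x) ^ (-(4 : ℤ))‖
      ≤ ∫ x in (0 : ℝ)..n, 1 / (4 * π) * (((w.re + x) ^ 2 + w.im ^ 2) ^ 2)⁻¹ :=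
        intervalIntegral.norm_integral_le_of_norm_le (Nat.cast_nonneg n) hpt
          (hcont.intervalIntegrable _ _)
    _ = 1 / (4 * π) * ∫ x in (0 : ℝ)..n, (((w.re + x) ^ 2 + w.im ^ 2) ^ 2)⁻¹ :=
        intervalIntegral.integral_const_mul _ _
    _ ≤ 1 / (4 * π) * ((π + 1) / (2 * w.im ^ 3)) :=
        mul_le_mul_of_nonneg_left (integral_inv_sq_add_sq_sq_le hw n) (by positivity)
    _ = (π + 1) / (8 * π * w.im ^ 3) := by
        field_simp
        ring

/-- `log n − Log(w + n) → 0` in `ℂ` (`Im w ≠ 0`). [folklore] -/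
private lemma tendsto_log_nat_sub_clog_add {w : ℂ} (hw : w.im ≠ 0) :
    Tendsto (fun n : ℕ ↦ (Real.log n : ℂ) - Complex.log (w + n)) atTop (𝓝 0) := by
  have h1 : Tendsto (fun n : ℕ ↦ w / n + 1) atTop (𝓝 1) := by
    have := (tendsto_const_div_atTop_nhds_zero_nat w).add (tendsto_const_nhds (x := (1 : ℂ)))
    simpa using this
  have h2 : Tendsto (fun n : ℕ ↦ Complex.log (w / n + 1)) atTop (𝓝 0) := by
    have hc : ContinuousAt Complex.log 1 := continuousAt_clog (by simp [slitPlane])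
    have := hc.tendsto.comp h1
    rw [Complex.log_one] at this
    exact this
  have h3 : ∀ᶠ n : ℕ in atTop, (Real.log n : ℂ) - Complex.log (w + n) = -Complex.log (w / n + 1) := by
    filter_upwards [eventually_ne_atTop 0] with n hn
    have hn0 : (0 : ℝ) < n := Nat.cast_pos.2 (Nat.pos_of_ne_zero hn)
    have hne : w / n + 1 ≠ 0 := by
      intro h
      have := congrArg Complex.im h
      simp [Complex.div_natCast_im] at this
      rcases this with h0 | h0
      · exact hw h0
      · exact hn h0
    have hwn : w + n = (n : ℝ) * (w / n + 1) := by
      have : (n : ℂ) ≠ 0 := by exact_mod_cast hn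
      push_cast
      field_simp
    rw [hwn, Complex.log_ofReal_mul hn0 hne]
    push_cast
    ring
  rw [tendsto_congr' h3]
  simpa using h2.neg

/-- `((w + n)^p)⁻¹ → 0` for `p ≥ 1`, any `w`. [folklore] -/
private lemma tendsto_inv_pow_add_nat (w : ℂ) {p : ℕ} (hp : 1 ≤ p) :
    Tendsto (fun n : ℕ ↦ ((w + n) ^ p)⁻¹) atTop (𝓝 0) := by
  have hg : Tendsto (fun n : ℕ ↦ 1 / ((n : ℝ) - ‖w‖)) atTop (𝓝 0) := by
    have h1 : Tendsto (fun n : ℕ ↦ (n : ℝ) - ‖w‖) atTop atTop :=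
      tendsto_atTop_add_const_right _ _ tendsto_natCast_atTop_atTop
    have h2 := h1.inv_tendsto_atTop
    simp only [one_div]
    exact h2
  refine squeeze_zero_norm' ?_ hg
  filter_upwards [eventually_ge_atTop (⌈‖w‖⌉₊ + 1)] with n hn
  have hn1 : ‖w‖ + 1 ≤ n := by
    have h1 : (⌈‖w‖⌉₊ : ℝ) + 1 ≤ n := by exact_mod_cast hn
    linarith [Nat.le_ceil ‖w‖]
  have hwn : (n : ℝ) - ‖w‖ ≤ ‖w + n‖ := by
    have := norm_sub_le (w + n) w
    simp only [add_sub_cancel_left, Complex.norm_natCast] at this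
    linarith
  have hpos : 0 < (n : ℝ) - ‖w‖ := by linarith
  rw [norm_inv, norm_pow, one_div]
  refine inv_anti₀ hpos (hwn.trans ?_)
  exact le_self_pow₀ (by linarith) (by omega)

/-- **Stirling's formula for `ψ` with the `B₂` term, in the upper half-plane**: for `Im w > 0`,
`‖ψ(w) − (Log w − 1/(2w) − 1/(12w²))‖ ≤ (π + 1)/(8π (Im w)³)` (Euler–Maclaurin of order one on
Gauss's formula; the remainder `∫_0^∞ B̄₃(x)(w+x)^{−4} dx` is bounded through
`∫ dx/((Re w + x)² + (Im w)²)² ≤ (π+1)/(2 (Im w)³)`, uniformly in `Re w`).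
[cite: AndrewsAskeyRoy1999, Thm 1.2.5 and Cor 1.4.5] -/
theorem norm_digamma_sub_stirling_le_of_im_pos {w : ℂ} (hw : 0 < w.im) :
    ‖digamma w - (Complex.log w - 1 / (2 * w) - 1 / (12 * w ^ 2))‖ ≤
      (π + 1) / (8 * π * w.im ^ 3) := by
  have hw' : w.im ≠ 0 := hw.ne'
  set G : ℕ → ℝ → ℂ := fun j y ↦ (-1 : ℂ) ^ j * (j.factorial : ℂ) * (w + y) ^ (-(j + 1 : ℤ)) with hG
  set Main : ℂ := Complex.log w - 1 / (2 * w) - 1 / (12 * w ^ 2) with hMain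
  set Bnd : ℝ := (π + 1) / (8 * π * w.im ^ 3) with hBnd
  have hw0 : w ≠ 0 := fun h ↦ by rw [h] at hw; simp at hw
  have hG0 : ∀ y : ℝ, G 0 y = (w + y)⁻¹ := by intro y; simp [hG]
  have hG1 : ∀ y : ℝ, G 1 y = -((w + y) ^ 2)⁻¹ := by
    intro y
    simp only [hG, pow_one, Nat.factorial_one, Nat.cast_one, mul_one]
    rw [show (-(1 + 1) : ℤ) = -((2 : ℕ) : ℤ) by norm_num, zpow_neg, zpow_natCast]
    ring
  have hG3 : ∀ y : ℝ, (1 : ℂ) / ((2 * 1 + 1).factorial : ℂ) *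
      ((bernoulliPer (2 * 1 + 1) y : ℂ) * G (2 * 1 + 1) y) =
        -((bernoulliPer 3 y : ℂ) * (w + y) ^ (-(4 : ℤ))) := by
    intro y
    simp only [hG, show 2 * 1 + 1 = 3 from rfl]
    rw [show (-(((3 : ℕ) : ℤ) + 1) : ℤ) = -(4 : ℤ) by norm_num]
    norm_num [Nat.factorial]
    ring
  -- Euler–Maclaurin at finite `n`
  have hEM : ∀ n : ℕ, ∑ m ∈ Finset.Ioc 0 n, G 0 m =
      (Complex.log (w + n) - Complex.log w) + (G 0 n - G 0 0) / 2 +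
        ∑ k ∈ Finset.Icc 1 1, (bernoulli (2 * k) : ℂ) / (2 * k).factorial *
          (G (2 * k - 1) n - G (2 * k - 1) 0) +
        1 / (2 * 1 + 1).factorial *
          ∫ x in ((0 : ℕ) : ℝ)..n, (bernoulliPer (2 * 1 + 1) x : ℂ) * G (2 * 1 + 1) x := by
    intro n
    have hg : ∀ j, ∀ x ∈ Icc ((0 : ℕ) : ℝ) n, HasDerivAt (G j) (G (j + 1) x) x := by
      intro j x _
      have h := hasDerivAt_gFam hw' j x
      rw [hG]
      refine h.congr_deriv ?_
      push_cast
      ring_nf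
    have hI : ∫ x in ((0 : ℕ) : ℝ)..n, G 0 x = Complex.log (w + n) - Complex.log w := by
      rw [Nat.cast_zero]
      exact integral_gFam_zero hw' n
    have := eulerMaclaurin_family hg (Nat.zero_le n) 1
    rw [this, hI, Nat.cast_zero]
  have hb2 : (bernoulli 2 : ℚ) = 1 / 6 := by
    rw [bernoulli_eq_bernoulli'_of_ne_one (by decide), bernoulli'_two, one_div]
  -- the finite-`n` identity and the bound
  have hkey : ∀ n : ℕ, ‖((Real.log n : ℂ) - ∑ j ∈ Finset.range (n + 1), 1 / (w + j)) -
      (((Real.log n : ℂ) - Complex.log (w + n)) - (w + n)⁻¹ / 2 + (1 / 12) * ((w + n) ^ 2)⁻¹) -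
        Main‖ ≤ Bnd := by
    intro n
    have hS : ∑ j ∈ Finset.range (n + 1), 1 / (w + j) = w⁻¹ + ∑ m ∈ Finset.Ioc 0 n, G 0 m := by
      have : ∑ j ∈ Finset.range (n + 1), 1 / (w + (j : ℂ)) =
          1 / (w + ((0 : ℕ) : ℂ)) + ∑ m ∈ Finset.Ioc 0 n, 1 / (w + (m : ℂ)) := by
        induction n with
        | zero => simp
        | succ n ih =>
          rw [Finset.sum_range_succ, ih, Finset.sum_Ioc_succ_top (Nat.zero_le _), add_assoc]
      rw [this]
      simp only [hG0, Nat.cast_zero, add_zero, one_div, Complex.ofReal_natCast]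
    have hG0n : G 0 n = (w + n)⁻¹ := by rw [hG0, Complex.ofReal_natCast]
    have hG00 : G 0 0 = w⁻¹ := by
      have := hG0 0
      rw [Complex.ofReal_zero, add_zero] at this
      exact_mod_cast this
    have hG1n : G 1 n = -((w + n) ^ 2)⁻¹ := by rw [hG1, Complex.ofReal_natCast]
    have hG10 : G 1 0 = -(w ^ 2)⁻¹ := by
      have := hG1 0
      rw [Complex.ofReal_zero, add_zero] at this
      exact_mod_cast this
    have hsumK : ∑ k ∈ Finset.Icc 1 1, (bernoulli (2 * k) : ℂ) / (2 * k).factorial *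
        (G (2 * k - 1) n - G (2 * k - 1) 0) = (1 / 12) * (-((w + n) ^ 2)⁻¹ + (w ^ 2)⁻¹) := by
      rw [Finset.Icc_self, Finset.sum_singleton]
      simp only [mul_one, show 2 - 1 = 1 from rfl, hG1n, hG10, hb2]
      push_cast
      norm_num [Nat.factorial]
    have hR : (1 : ℂ) / ((2 * 1 + 1).factorial : ℂ) *
        ∫ x in ((0 : ℕ) : ℝ)..n, (bernoulliPer (2 * 1 + 1) x : ℂ) * G (2 * 1 + 1) x =
        -∫ x in (0 : ℝ)..n, (bernoulliPer 3 x : ℂ) * (w + x) ^ (-(4 : ℤ)) := by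
      rw [Nat.cast_zero, ← intervalIntegral.integral_const_mul, ← intervalIntegral.integral_neg]
      refine intervalIntegral.integral_congr fun x _ ↦ ?_
      exact hG3 x
    have hid : ((Real.log n : ℂ) - ∑ j ∈ Finset.range (n + 1), 1 / (w + j)) -
        (((Real.log n : ℂ) - Complex.log (w + n)) - (w + n)⁻¹ / 2 + (1 / 12) * ((w + n) ^ 2)⁻¹) -
          Main = ∫ x in (0 : ℝ)..n, (bernoulliPer 3 x : ℂ) * (w + x) ^ (-(4 : ℤ)) := by
      rw [hS, hEM n, hsumK, hR, hG0n, hG00, hMain]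
      field_simp
      ring
    rw [hid]
    exact norm_integral_bernoulliPer_three_le hw n
  -- pass to the limit
  have hA := tendsto_log_sub_sum_inv_digamma_of_im_ne_zero hw'
  have hV : Tendsto (fun n : ℕ ↦ ((Real.log n : ℂ) - Complex.log (w + n)) - (w + n)⁻¹ / 2 +
      (1 / 12) * ((w + n) ^ 2)⁻¹) atTop (𝓝 0) := by
    have h1 := tendsto_log_nat_sub_clog_add hw'
    have h2 : Tendsto (fun n : ℕ ↦ (w + n)⁻¹ / 2) atTop (𝓝 0) := by
      have := (tendsto_inv_pow_add_nat w (le_refl 1)).div_const 2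
      simpa using this
    have h3 : Tendsto (fun n : ℕ ↦ (1 / 12 : ℂ) * ((w + n) ^ 2)⁻¹) atTop (𝓝 0) := by
      have := (tendsto_inv_pow_add_nat w (by norm_num : 1 ≤ 2)).const_mul (1 / 12 : ℂ)
      simpa using this
    have := (h1.sub h2).add h3
    simpa using this
  have hlim := (hA.sub hV).sub (tendsto_const_nhds (x := Main))
  have hnorm := (continuous_norm.tendsto _).comp hlim
  have hle := le_of_tendsto' hnorm hkey
  simpa using hle


/-! ### `Γ` and `ψ` on the slit plane; transport of `Γ e^{−S}` along segments -/

/-- Binet's remainder derivative `μ'(w) = ψ(w) − (Log w − 1/(2w) − 1/(12w²))` (the derivative of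
`log Γ(w) − ((w − ½) Log w − w + ½ log 2π + 1/(12w))`, i.e. of Binet's function minus its first
Stirling term). [cite: WhittakerWatson1927, §12.33] -/
def binetDeriv (w : ℂ) : ℂ := digamma w - (Complex.log w - 1 / (2 * w) - 1 / (12 * w ^ 2))

/-- The Stirling exponent with the first Binet term, `S(w) = (w − ½) Log w − w + 1/(12w)` (Stirling's
series for `log Γ(w) − ½ log 2π` truncated after `B₂/(1·2·w)`). [cite: WhittakerWatson1927, §12.33] -/
def stirlingExp (w : ℂ) : ℂ := (w - 1 / 2) * Complex.log w - w + 1 / (12 * w)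

/-- Unfolding lemma for `binetDeriv`. [folklore] -/
private theorem binetDeriv_def (w : ℂ) :
    binetDeriv w = digamma w - (Complex.log w - 1 / (2 * w) - 1 / (12 * w ^ 2)) := rfl

/-- Unfolding lemma for `stirlingExp`. [folklore] -/
private theorem stirlingExp_def (w : ℂ) : stirlingExp w = (w - 1 / 2) * Complex.log w - w + 1 / (12 * w) := rfl

/-- `‖μ'(w)‖ ≤ (π+1)/(8π (Im w)³)` for `Im w > 0` (restatement of
`norm_digamma_sub_stirling_le_of_im_pos`). [folklore] -/
private theorem norm_binetDeriv_le {w : ℂ} (hw : 0 < w.im) :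
    ‖binetDeriv w‖ ≤ (π + 1) / (8 * π * w.im ^ 3) :=
  norm_digamma_sub_stirling_le_of_im_pos hw

/-- Points of the slit plane are not poles of `Γ`. [folklore] -/
private theorem ne_neg_nat_of_mem_slitPlane {w : ℂ} (hw : w ∈ slitPlane) (m : ℕ) : w ≠ -m := by
  intro h
  rw [h] at hw
  rcases hw with h1 | h1
  · simp at h1
    linarith [(Nat.cast_nonneg m : (0 : ℝ) ≤ m)]
  · simp at h1

/-- `Γ` is holomorphic on the slit plane. [folklore] -/
private theorem differentiableOn_Gamma_slitPlane : DifferentiableOn ℂ Complex.Gamma slitPlane :=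
  fun w hw ↦ (Complex.differentiableAt_Gamma w (ne_neg_nat_of_mem_slitPlane hw)).differentiableWithinAt

/-- `ψ = Γ'/Γ` is holomorphic on the slit plane. [folklore] -/
private theorem differentiableOn_digamma_slitPlane : DifferentiableOn ℂ digamma slitPlane := by
  have hG := differentiableOn_Gamma_slitPlane
  have hG' : DifferentiableOn ℂ (deriv Complex.Gamma) slitPlane :=
    (hG.analyticOnNhd Complex.isOpen_slitPlane).deriv.differentiableOn
  have : digamma = fun w ↦ deriv Complex.Gamma w / Complex.Gamma w := by
    funext w; rw [Complex.digamma_def, logDeriv_apply]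
  rw [this]
  exact hG'.div hG fun w hw ↦ Complex.Gamma_ne_zero (ne_neg_nat_of_mem_slitPlane hw)

/-- `ψ` is continuous on the slit plane. [folklore] -/
private theorem continuousOn_digamma_slitPlane : ContinuousOn digamma slitPlane :=
  differentiableOn_digamma_slitPlane.continuousOn

/-- `S'(w) = Log w − 1/(2w) − 1/(12w²)` on the slit plane. [folklore] -/
private theorem hasDerivAt_stirlingExp {w : ℂ} (hw : w ∈ slitPlane) :
    HasDerivAt stirlingExp (Complex.log w - 1 / (2 * w) - 1 / (12 * w ^ 2)) w := by
  have hw0 : w ≠ 0 := Complex.slitPlane_ne_zero hw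
  have h1 : HasDerivAt (fun w : ℂ ↦ (w - 1 / 2) * Complex.log w)
      (1 * Complex.log w + (w - 1 / 2) * w⁻¹) w :=
    ((hasDerivAt_id w).sub_const _).mul (Complex.hasDerivAt_log hw)
  have h12 : (12 : ℂ) * w ≠ 0 := mul_ne_zero (by norm_num) hw0
  have h2 : HasDerivAt (fun w : ℂ ↦ 1 / (12 * w)) (-(12 * 1) / (12 * w) ^ 2) w := by
    have h := ((hasDerivAt_id w).const_mul (12 : ℂ)).inv (by simpa using h12)
    have e : (fun w : ℂ ↦ 1 / (12 * w)) = fun y ↦ (12 * id y)⁻¹ := by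
      funext y; rw [one_div]; rfl
    rw [e]
    exact h
  have h3 := (h1.sub (hasDerivAt_id w)).add h2
  have e2 : stirlingExp = fun w : ℂ ↦ (w - 1 / 2) * Complex.log w - id w + 1 / (12 * w) := by
    funext x; simp only [stirlingExp, id]
  rw [e2]
  refine h3.congr_deriv ?_
  field_simp
  ring

/-- **`Γ(w₀ + d) = Γ(w₀)·exp(∫_{[w₀,w₀+d]} ψ)`** along any segment contained in the slit plane
(`G(τ) = Γ(w₀+τd) e^{−∫_0^τ ψ d}` has zero derivative; the tree's
`Gamma_eq_mul_exp_integral_digamma` is the case of the open upper half-plane). [folklore] -/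
private theorem Gamma_eq_mul_exp_integral_digamma_seg {w₀ d : ℂ}
    (hU : ∀ τ ∈ Icc (0 : ℝ) 1, w₀ + τ * d ∈ slitPlane) :
    Complex.Gamma (w₀ + d) = Complex.Gamma w₀ * Complex.exp (∫ τ in (0 : ℝ)..1, digamma (w₀ + τ * d) * d) := by
  set seg : ℝ → ℂ := fun τ ↦ w₀ + τ * d with hseg
  have hpole : ∀ τ ∈ Icc (0 : ℝ) 1, ∀ m : ℕ, seg τ ≠ -m := fun τ hτ m ↦
    ne_neg_nat_of_mem_slitPlane (hU τ hτ) m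
  -- clamped integrand, continuous on all of `ℝ`
  set cl : ℝ → ℝ := fun σ ↦ max 0 (min σ 1) with hcl
  have hcl_mem : ∀ σ, cl σ ∈ Icc (0 : ℝ) 1 := fun σ ↦
    ⟨le_max_left _ _, max_le zero_le_one (min_le_right _ _)⟩
  have hcl_id : ∀ σ ∈ Icc (0 : ℝ) 1, cl σ = σ := fun σ hσ ↦ by
    simp only [hcl]; rw [min_eq_left hσ.2, max_eq_right hσ.1]
  have hcl_cont : Continuous cl := by fun_prop
  set f : ℝ → ℂ := fun σ ↦ digamma (seg (cl σ)) * d with hf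
  have hf_cont : Continuous f := by
    refine Continuous.mul ?_ continuous_const
    have hsegc : Continuous fun σ ↦ seg (cl σ) := by
      simp only [hseg]; fun_prop
    exact continuousOn_digamma_slitPlane.comp_continuous hsegc fun σ ↦ hU _ (hcl_mem σ)
  set P : ℝ → ℂ := fun τ ↦ ∫ σ in (0 : ℝ)..τ, f σ with hP
  have hP_deriv : ∀ τ, HasDerivAt P (f τ) τ := fun τ ↦
    intervalIntegral.integral_hasDerivAt_right (hf_cont.intervalIntegrable _ _)
      (hf_cont.stronglyMeasurableAtFilter _ _) hf_cont.continuousAt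
  set G : ℝ → ℂ := fun τ ↦ Complex.Gamma (seg τ) * Complex.exp (-P τ) with hG
  have hG_deriv : ∀ τ ∈ Icc (0 : ℝ) 1, HasDerivAt G 0 τ := by
    intro τ hτ
    have hΓd := Complex.differentiableAt_Gamma _ (hpole τ hτ)
    have hΓ : HasDerivAt (fun τ : ℝ ↦ Complex.Gamma (seg τ)) (deriv Complex.Gamma (seg τ) * d) τ := by
      have h1 : HasDerivAt (fun z : ℂ ↦ Complex.Gamma (w₀ + z * d)) (deriv Complex.Gamma (seg τ) * d) (τ : ℂ) := by
        have hi : HasDerivAt (fun z : ℂ ↦ w₀ + z * d) d (τ : ℂ) := by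
          simpa using ((hasDerivAt_id (τ : ℂ)).mul_const d).const_add w₀
        exact hΓd.hasDerivAt.comp (τ : ℂ) hi
      exact h1.comp_ofReal
    have hE : HasDerivAt (fun τ : ℝ ↦ Complex.exp (-P τ)) (Complex.exp (-P τ) * -f τ) τ :=
      (hP_deriv τ).neg.cexp
    have hprod := hΓ.mul hE
    have hdΓ : deriv Complex.Gamma (seg τ) = digamma (seg τ) * Complex.Gamma (seg τ) := by
      rw [Complex.digamma_def, logDeriv_apply,
        div_mul_cancel₀ _ (Complex.Gamma_ne_zero (hpole τ hτ))]
    have hfτ : f τ = digamma (seg τ) * d := by simp only [hf, hcl_id τ hτ]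
    have hzero : deriv Complex.Gamma (seg τ) * d * Complex.exp (-P τ) +
        Complex.Gamma (seg τ) * (Complex.exp (-P τ) * -f τ) = 0 := by
      rw [hdΓ, hfτ]; ring
    rw [hzero] at hprod
    exact hprod
  have hG_cont : ContinuousOn G (Icc 0 1) := fun τ hτ ↦ (hG_deriv τ hτ).continuousAt.continuousWithinAt
  have hconst := constant_of_has_deriv_right_zero hG_cont
    (fun τ hτ ↦ (hG_deriv τ (Ico_subset_Icc_self hτ)).hasDerivWithinAt) 1 ⟨zero_le_one, le_rfl⟩
  have hP0 : P 0 = 0 := by simp [hP]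
  have hseg0 : seg 0 = w₀ := by simp [hseg]
  have hseg1 : seg 1 = w₀ + d := by simp [hseg]
  have hP1 : P 1 = ∫ τ in (0 : ℝ)..1, digamma (w₀ + τ * d) * d := by
    simp only [hP]
    refine intervalIntegral.integral_congr fun σ hσ ↦ ?_
    rw [Set.uIcc_of_le zero_le_one] at hσ
    simp only [hf, hseg, hcl_id σ hσ]
  simp only [hG, hseg0, hseg1, hP0, neg_zero, Complex.exp_zero, mul_one] at hconst
  rw [← hP1, ← hconst, mul_assoc, ← Complex.exp_add, neg_add_cancel, Complex.exp_zero, mul_one]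

/-- FTC for the Stirling exponent along a segment of the slit plane:
`S(w₀ + d) − S(w₀) = ∫_0^1 S'(w₀ + τd) d dτ`. [folklore] -/
private theorem stirlingExp_sub_eq_integral_seg {w₀ d : ℂ}
    (hU : ∀ τ ∈ Icc (0 : ℝ) 1, w₀ + τ * d ∈ slitPlane) :
    stirlingExp (w₀ + d) - stirlingExp w₀ =
      ∫ τ in (0 : ℝ)..1, (Complex.log (w₀ + τ * d) - 1 / (2 * (w₀ + τ * d)) -
        1 / (12 * (w₀ + τ * d) ^ 2)) * d := by
  have hderiv : ∀ τ ∈ uIcc (0 : ℝ) 1, HasDerivAt (fun τ : ℝ ↦ stirlingExp (w₀ + τ * d))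
      ((Complex.log (w₀ + τ * d) - 1 / (2 * (w₀ + τ * d)) - 1 / (12 * (w₀ + τ * d) ^ 2)) * d) τ := by
    intro τ hτ
    rw [uIcc_of_le zero_le_one] at hτ
    have h1 : HasDerivAt (fun z : ℂ ↦ stirlingExp (w₀ + z * d))
        ((Complex.log (w₀ + τ * d) - 1 / (2 * (w₀ + τ * d)) - 1 / (12 * (w₀ + τ * d) ^ 2)) * d)
        (τ : ℂ) := by
      have hi : HasDerivAt (fun z : ℂ ↦ w₀ + z * d) d (τ : ℂ) := by
        simpa using ((hasDerivAt_id (τ : ℂ)).mul_const d).const_add w₀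
      exact (hasDerivAt_stirlingExp (hU τ hτ)).comp (τ : ℂ) hi
    exact h1.comp_ofReal
  have hcont : ContinuousOn (fun τ : ℝ ↦ (Complex.log (w₀ + τ * d) - 1 / (2 * (w₀ + τ * d)) -
      1 / (12 * (w₀ + τ * d) ^ 2)) * d) (uIcc (0 : ℝ) 1) := by
    rw [uIcc_of_le zero_le_one]
    intro τ hτ
    have hmem := hU τ hτ
    have hne : w₀ + (τ : ℂ) * d ≠ 0 := Complex.slitPlane_ne_zero hmem
    refine ContinuousAt.continuousWithinAt ?_
    refine ContinuousAt.mul ?_ continuousAt_const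
    have hsegc : ContinuousAt (fun τ : ℝ ↦ w₀ + (τ : ℂ) * d) τ := by fun_prop
    refine ContinuousAt.sub (ContinuousAt.sub ?_ ?_) ?_
    · exact (continuousAt_clog hmem).comp (f := fun τ : ℝ ↦ w₀ + (τ : ℂ) * d) hsegc
    · exact ContinuousAt.div continuousAt_const (by fun_prop) (mul_ne_zero two_ne_zero hne)
    · exact ContinuousAt.div continuousAt_const (by fun_prop) (mul_ne_zero (by norm_num) (pow_ne_zero 2 hne))
  have := integral_eq_sub_of_hasDerivAt hderiv (hcont.intervalIntegrable)
  simpa using this.symm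

/-- **Transport of `Q = Γ e^{−S}` along a segment of the slit plane**:
`Q(w₀ + d) = Q(w₀) exp(∫_0^1 μ'(w₀ + τd) d dτ)`, `μ' = binetDeriv`. [folklore] -/
private theorem Gamma_mul_exp_neg_stirlingExp_seg {w₀ d : ℂ}
    (hU : ∀ τ ∈ Icc (0 : ℝ) 1, w₀ + τ * d ∈ slitPlane) :
    Complex.Gamma (w₀ + d) * Complex.exp (-stirlingExp (w₀ + d)) =
      Complex.Gamma w₀ * Complex.exp (-stirlingExp w₀) *
        Complex.exp (∫ τ in (0 : ℝ)..1, binetDeriv (w₀ + τ * d) * d) := by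
  have hΓ := Gamma_eq_mul_exp_integral_digamma_seg hU
  have hS := stirlingExp_sub_eq_integral_seg hU
  -- interval integrability of the two integrands (both continuous on `[0,1]`)
  have hmem : ∀ τ ∈ uIcc (0 : ℝ) 1, w₀ + (τ : ℂ) * d ∈ slitPlane := by
    rw [uIcc_of_le zero_le_one]; exact hU
  have hc1 : ContinuousOn (fun τ : ℝ ↦ digamma (w₀ + τ * d) * d) (uIcc (0 : ℝ) 1) := by
    refine ContinuousOn.mul ?_ continuousOn_const
    exact continuousOn_digamma_slitPlane.comp (by fun_prop) fun τ hτ ↦ hmem τ hτ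
  have hc2 : ContinuousOn (fun τ : ℝ ↦ (Complex.log (w₀ + τ * d) - 1 / (2 * (w₀ + τ * d)) -
      1 / (12 * (w₀ + τ * d) ^ 2)) * d) (uIcc (0 : ℝ) 1) := by
    intro τ hτ
    have hm := hmem τ hτ
    have hne : w₀ + (τ : ℂ) * d ≠ 0 := Complex.slitPlane_ne_zero hm
    refine ContinuousAt.continuousWithinAt (ContinuousAt.mul ?_ continuousAt_const)
    have hsegc : ContinuousAt (fun τ : ℝ ↦ w₀ + (τ : ℂ) * d) τ := by fun_prop
    refine ContinuousAt.sub (ContinuousAt.sub ?_ ?_) ?_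
    · exact (continuousAt_clog hm).comp (f := fun τ : ℝ ↦ w₀ + (τ : ℂ) * d) hsegc
    · exact ContinuousAt.div continuousAt_const (by fun_prop) (mul_ne_zero two_ne_zero hne)
    · exact ContinuousAt.div continuousAt_const (by fun_prop) (mul_ne_zero (by norm_num) (pow_ne_zero 2 hne))
  have hsub : ∫ τ in (0 : ℝ)..1, binetDeriv (w₀ + τ * d) * d =
      (∫ τ in (0 : ℝ)..1, digamma (w₀ + τ * d) * d) -
        ∫ τ in (0 : ℝ)..1, (Complex.log (w₀ + τ * d) - 1 / (2 * (w₀ + τ * d)) -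
          1 / (12 * (w₀ + τ * d) ^ 2)) * d := by
    rw [← intervalIntegral.integral_sub hc1.intervalIntegrable hc2.intervalIntegrable]
    refine intervalIntegral.integral_congr fun τ _ ↦ ?_
    simp only [binetDeriv]
    ring
  rw [hsub, ← hS, hΓ, mul_assoc, mul_assoc, ← Complex.exp_add, ← Complex.exp_add]
  congr 2
  ring

/-- Vertical transport of `Γ`: for `Re z > 0` or `Im z > 0` and `Y ≥ 0`,
`Γ(z + iY) = Γ(z) exp(i ∫_0^Y ψ(z + iy) dy)`. [folklore] -/
private theorem Gamma_vertical_eq {z : ℂ} (hz : 0 < z.re ∨ 0 < z.im) {Y : ℝ} (hY : 0 ≤ Y) :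
    Complex.Gamma (z + Y * I) = Complex.Gamma z * Complex.exp (I * ∫ y in (0 : ℝ)..Y, digamma (z + y * I)) := by
  rcases hY.eq_or_lt with rfl | hY0
  · simp
  have hU : ∀ τ ∈ Icc (0 : ℝ) 1, z + τ * (Y * I) ∈ slitPlane := by
    intro τ hτ
    rcases hz with h | h
    · left; simpa using h
    · right
      have : 0 < z.im + τ * Y := by nlinarith [hτ.1]
      simp; linarith
  have h := Gamma_eq_mul_exp_integral_digamma_seg hU
  have hsub : ∫ τ in (0 : ℝ)..1, digamma (z + τ * (Y * I)) * (Y * I) =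
      I * ∫ y in (0 : ℝ)..Y, digamma (z + y * I) := by
    have e1 : (fun τ : ℝ ↦ digamma (z + τ * (Y * I)) * (Y * I)) =
        fun τ : ℝ ↦ ((Y : ℂ) * I) * (fun y : ℝ ↦ digamma (z + y * I)) (Y * τ) := by
      funext τ; push_cast; ring_nf
    rw [e1, intervalIntegral.integral_const_mul,
      intervalIntegral.integral_comp_mul_left (fun y : ℝ ↦ digamma (z + y * I)) hY0.ne']
    simp only [mul_zero, mul_one]
    rw [Complex.real_smul]
    have hYc : (Y : ℂ) ≠ 0 := by exact_mod_cast hY0.ne'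
    push_cast
    rw [← mul_assoc, mul_comm ((Y : ℂ) * I), ← mul_assoc, inv_mul_cancel₀ hYc, one_mul]
  rw [h, hsub]

/-- Vertical transport of `Q = Γ e^{−S}` in the upper half-plane: for `Im z > 0`, `Y ≥ 0`,
`Q(z + iY) = Q(z) exp(i ∫_0^Y μ'(z + iy) dy)`. [folklore] -/
private theorem Gamma_mul_exp_neg_stirlingExp_vertical {z : ℂ} (hz : 0 < z.im) {Y : ℝ} (hY : 0 ≤ Y) :
    Complex.Gamma (z + Y * I) * Complex.exp (-stirlingExp (z + Y * I)) =
      Complex.Gamma z * Complex.exp (-stirlingExp z) *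
        Complex.exp (I * ∫ y in (0 : ℝ)..Y, binetDeriv (z + y * I)) := by
  rcases hY.eq_or_lt with rfl | hY0
  · simp
  have hU : ∀ τ ∈ Icc (0 : ℝ) 1, z + τ * (Y * I) ∈ slitPlane := by
    intro τ hτ
    right
    have : 0 < z.im + τ * Y := by nlinarith [hτ.1]
    simp; linarith
  have h := Gamma_mul_exp_neg_stirlingExp_seg hU
  have hsub : ∫ τ in (0 : ℝ)..1, binetDeriv (z + τ * (Y * I)) * (Y * I) =
      I * ∫ y in (0 : ℝ)..Y, binetDeriv (z + y * I) := by
    have e1 : (fun τ : ℝ ↦ binetDeriv (z + τ * (Y * I)) * (Y * I)) =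
        fun τ : ℝ ↦ ((Y : ℂ) * I) * (fun y : ℝ ↦ binetDeriv (z + y * I)) (Y * τ) := by
      funext τ; push_cast; ring_nf
    rw [e1, intervalIntegral.integral_const_mul,
      intervalIntegral.integral_comp_mul_left (fun y : ℝ ↦ binetDeriv (z + y * I)) hY0.ne']
    simp only [mul_zero, mul_one]
    rw [Complex.real_smul]
    have hYc : (Y : ℂ) ≠ 0 := by exact_mod_cast hY0.ne'
    push_cast
    rw [← mul_assoc, mul_comm ((Y : ℂ) * I), ← mul_assoc, inv_mul_cancel₀ hYc, one_mul]
  rw [h, hsub]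

/-- `μ'` is continuous on the slit plane. [folklore] -/
private theorem continuousOn_binetDeriv_slitPlane : ContinuousOn binetDeriv slitPlane := by
  have e : binetDeriv = fun w ↦ digamma w - (Complex.log w - 1 / (2 * w) - 1 / (12 * w ^ 2)) := rfl
  rw [e]
  refine continuousOn_digamma_slitPlane.sub (ContinuousOn.sub (ContinuousOn.sub ?_ ?_) ?_)
  · exact fun w hw ↦ (continuousAt_clog hw).continuousWithinAt
  · intro w hw
    have hw0 : w ≠ 0 := Complex.slitPlane_ne_zero hw
    have hc : ContinuousAt (fun w : ℂ ↦ 2 * w) w := by fun_prop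
    have h2 : (2 : ℂ) * w ≠ 0 := mul_ne_zero two_ne_zero hw0
    exact (continuousAt_const.div hc h2).continuousWithinAt
  · intro w hw
    have hw0 : w ≠ 0 := Complex.slitPlane_ne_zero hw
    have hc : ContinuousAt (fun w : ℂ ↦ 12 * w ^ 2) w := by fun_prop
    have h12 : (12 : ℂ) * w ^ 2 ≠ 0 := mul_ne_zero (by norm_num) (pow_ne_zero 2 hw0)
    exact (continuousAt_const.div hc h12).continuousWithinAt

/-- Continuity of `y ↦ μ'(z + iy)` on `[0, ∞)` for `Im z > 0`. [folklore] -/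
private theorem continuousOn_binetDeriv_vertical {z : ℂ} (hz : 0 < z.im) :
    ContinuousOn (fun y : ℝ ↦ binetDeriv (z + y * I)) (Ici 0) := by
  refine continuousOn_binetDeriv_slitPlane.comp (by fun_prop) fun y hy ↦ ?_
  right
  have : 0 < z.im + y := by
    have : (0 : ℝ) ≤ y := hy
    linarith
  simpa using this.ne'

/-- The integral of `‖μ'‖` up a vertical ray: for `Im z = u > 0` and `Y ≥ 0`,
`∫_0^Y ‖μ'(z + iy)‖ dy ≤ (π+1)/(16π u²)`. [folklore] -/
private theorem integral_norm_binetDeriv_vertical_le {z : ℂ} (hz : 0 < z.im) {Y : ℝ} (hY : 0 ≤ Y) :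
    ∫ y in (0 : ℝ)..Y, ‖binetDeriv (z + y * I)‖ ≤ (π + 1) / (16 * π * z.im ^ 2) := by
  set κ : ℝ := (π + 1) / (8 * π) with hκ
  have hκ0 : 0 ≤ κ := by positivity
  have hpt : ∀ y ∈ Icc (0 : ℝ) Y, ‖binetDeriv (z + y * I)‖ ≤ κ * ((z.im + y) ^ 3)⁻¹ := by
    intro y hy
    have him : (z + y * I).im = z.im + y := by simp
    have hpos : 0 < z.im + y := by linarith [hy.1]
    have h := norm_binetDeriv_le (w := z + y * I) (by rw [him]; exact hpos)
    rw [him] at h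
    refine h.trans (le_of_eq ?_)
    rw [hκ]
    field_simp
  have hderiv : ∀ y ∈ uIcc (0 : ℝ) Y,
      HasDerivAt (fun y : ℝ ↦ -κ * (2 * (z.im + y) ^ 2)⁻¹) (κ * ((z.im + y) ^ 3)⁻¹) y := by
    intro y hy
    rw [uIcc_of_le hY] at hy
    have hpos : 0 < z.im + y := by linarith [hy.1]
    have h1 : HasDerivAt (fun y : ℝ ↦ 2 * (z.im + y) ^ 2) (2 * (2 * (z.im + y))) y := by
      have := (((hasDerivAt_id y).const_add z.im).pow 2).const_mul 2
      simpa using this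
    have h2 := (h1.inv (by positivity)).const_mul (-κ)
    refine h2.congr_deriv ?_
    field_simp
  have hgc : ContinuousOn (fun y : ℝ ↦ κ * ((z.im + y) ^ 3)⁻¹) (uIcc (0 : ℝ) Y) := by
    rw [uIcc_of_le hY]
    refine ContinuousOn.mul continuousOn_const (ContinuousOn.inv₀ (by fun_prop) fun y hy ↦ ?_)
    have : 0 < z.im + y := by linarith [hy.1]
    positivity
  have hfc : IntervalIntegrable (fun y : ℝ ↦ ‖binetDeriv (z + y * I)‖) volume 0 Y := by
    refine ContinuousOn.intervalIntegrable ?_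
    rw [uIcc_of_le hY]
    exact ((continuousOn_binetDeriv_vertical hz).mono Icc_subset_Ici_self).norm
  calc ∫ y in (0 : ℝ)..Y, ‖binetDeriv (z + y * I)‖
      ≤ ∫ y in (0 : ℝ)..Y, κ * ((z.im + y) ^ 3)⁻¹ :=
        intervalIntegral.integral_mono_on hY hfc hgc.intervalIntegrable hpt
    _ = -κ * (2 * (z.im + Y) ^ 2)⁻¹ - -κ * (2 * (z.im + 0) ^ 2)⁻¹ :=
        integral_eq_sub_of_hasDerivAt hderiv hgc.intervalIntegrable
    _ ≤ κ * (2 * z.im ^ 2)⁻¹ := by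
        have h1 : 0 ≤ κ * (2 * (z.im + Y) ^ 2)⁻¹ := by positivity
        rw [add_zero]
        linarith
    _ = (π + 1) / (16 * π * z.im ^ 2) := by
        rw [hκ]
        field_simp
        ring

/-! ### Normalisation on the line `Re w = ½` -/

open Literature.NumberTheory.LFunctions (argGammaVert stirlingArgConst stirlingVertRate
  abs_argGammaVert_sub_stirling_le stirlingArgConst_add_stirlingArgConst_add_half)

/-- `c(½) = 0` for the Stirling constant of `arg Γ` (from `c(σ) + c(σ + ½) = c(2σ)` at
`σ = ½`). [folklore] -/
private theorem stirlingArgConst_one_half : stirlingArgConst (1 / 2) = 0 := by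
  have h := stirlingArgConst_add_stirlingArgConst_add_half (σ := 1 / 2) (by norm_num)
  have e1 : (1 / 2 : ℝ) + 1 / 2 = 1 := by norm_num
  have e2 : (2 : ℝ) * (1 / 2) = 1 := by norm_num
  rw [e1, e2] at h
  linarith

/-- `Γ(½ + iτ) = √π · exp(i ∫_0^τ ψ(½ + iy) dy)` for `τ ≥ 0`. [folklore] -/
private theorem Gamma_half_add_mul_I {τ : ℝ} (hτ : 0 ≤ τ) :
    Complex.Gamma (1 / 2 + τ * I) = (Real.sqrt π : ℂ) *
      Complex.exp (I * ∫ y in (0 : ℝ)..τ, digamma (1 / 2 + y * I)) := by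
  have h := Gamma_vertical_eq (z := 1 / 2) (Or.inl (by norm_num)) hτ
  rw [h]
  congr 1
  rw [show (1 / 2 : ℂ) = ((1 / 2 : ℝ) : ℂ) by push_cast; ring, Complex.Gamma_ofReal,
    Real.Gamma_one_half_eq]

/-- Continuity of `y ↦ ψ(½ + iy)`. [folklore] -/
private theorem continuous_digamma_half_line : Continuous fun y : ℝ ↦ digamma (1 / 2 + y * I) := by
  refine continuousOn_digamma_slitPlane.comp_continuous (by fun_prop) fun y ↦ ?_
  left
  simp

/-- `‖½ + iτ‖² = τ² + ¼`. [folklore] -/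
private theorem norm_half_add_mul_I_sq (τ : ℝ) : ‖(1 / 2 : ℂ) + τ * I‖ ^ 2 = τ ^ 2 + 1 / 4 := by
  rw [Complex.sq_norm, Complex.normSq_apply]
  simp
  ring

/-- For `τ ≥ 1`: `τ ≤ ‖½ + iτ‖` and `τ (log ‖½ + iτ‖ − log τ) ≤ 1/(8τ)`. [folklore] -/
private theorem mul_log_norm_half_sub_log_le {τ : ℝ} (hτ : 1 ≤ τ) :
    τ ≤ ‖(1 / 2 : ℂ) + τ * I‖ ∧ 0 ≤ τ * (Real.log ‖(1 / 2 : ℂ) + τ * I‖ - Real.log τ) ∧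
      τ * (Real.log ‖(1 / 2 : ℂ) + τ * I‖ - Real.log τ) ≤ 1 / (8 * τ) := by
  set x : ℝ := ‖(1 / 2 : ℂ) + τ * I‖ with hx
  have hτ0 : 0 < τ := by linarith
  have hx2 : x ^ 2 = τ ^ 2 + 1 / 4 := norm_half_add_mul_I_sq τ
  have hx0 : 0 ≤ x := norm_nonneg _
  have hτx : τ ≤ x := by nlinarith
  have hxpos : 0 < x := hτ0.trans_le hτx
  have hlog0 : 0 ≤ Real.log x - Real.log τ := by
    have := Real.log_le_log hτ0 hτx
    linarith
  refine ⟨hτx, mul_nonneg hτ0.le hlog0, ?_⟩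
  -- `x − τ ≤ 1/(8τ)` and `log x − log τ ≤ (x − τ)/τ`
  have hdiff : x - τ ≤ 1 / (8 * τ) := by
    rw [le_div_iff₀ (by positivity)]
    nlinarith
  have hlog : Real.log x - Real.log τ ≤ (x - τ) / τ := by
    have h1 : Real.log x - Real.log τ = Real.log (x / τ) := by
      rw [Real.log_div hxpos.ne' hτ0.ne']
    rw [h1]
    have h2 := Real.log_le_sub_one_of_pos (show 0 < x / τ by positivity)
    have h3 : x / τ - 1 = (x - τ) / τ := by field_simp
    linarith
  calc τ * (Real.log x - Real.log τ) ≤ τ * ((x - τ) / τ) :=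
        mul_le_mul_of_nonneg_left hlog hτ0.le
    _ = x - τ := by field_simp
    _ ≤ 1 / (8 * τ) := hdiff

/-- **Normalisation**: `Γ(½ + iτ) e^{−S(½ + iτ)} → √(2π)` as `τ → +∞`. The modulus by the uniform
Stirling bound `abs_log_norm_Gamma_sub_le`, the argument by the vertical Stirling expansion of
`arg Γ` on `Re = ½` (`abs_argGammaVert_sub_stirling_le`, `c(½) = 0`). [folklore] -/
private theorem tendsto_Gamma_mul_exp_neg_stirlingExp_half_line :
    Tendsto (fun τ : ℝ ↦ Complex.Gamma (1 / 2 + τ * I) * Complex.exp (-stirlingExp (1 / 2 + τ * I)))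
      atTop (𝓝 (Real.sqrt (2 * π) : ℂ)) := by
  set w : ℝ → ℂ := fun τ ↦ 1 / 2 + τ * I with hw
  set P : ℝ → ℂ := fun τ ↦ ∫ y in (0 : ℝ)..τ, digamma (1 / 2 + y * I) with hP
  set Λ : ℝ → ℂ := fun τ ↦ (Real.log (Real.sqrt π) : ℂ) + I * P τ - stirlingExp (w τ) with hΛ
  set L : ℂ := (Real.log (Real.sqrt (2 * π)) : ℂ) with hL
  set K : ℝ := stirlingVertRate (1 / 2) with hK
  set C : ℝ := 1 / 12 + π / 24 + 1 / 12 + (K + 1 / 8 + 1 / 12) with hC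
  have hsqrtπ : 0 < Real.sqrt π := Real.sqrt_pos.2 Real.pi_pos
  have hsqrt2π : 0 < Real.sqrt (2 * π) := Real.sqrt_pos.2 (by positivity)
  -- (1) `Q(w τ) = exp (Λ τ)` for `τ ≥ 0`
  have hQ : ∀ τ : ℝ, 0 ≤ τ →
      Complex.Gamma (w τ) * Complex.exp (-stirlingExp (w τ)) = Complex.exp (Λ τ) := by
    intro τ hτ
    have hΓ : Complex.Gamma (w τ) = (Real.sqrt π : ℂ) * Complex.exp (I * P τ) := Gamma_half_add_mul_I hτ
    rw [hΓ, hΛ]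
    simp only
    rw [sub_eq_add_neg, Complex.exp_add, Complex.exp_add, ← Complex.ofReal_exp,
      Real.exp_log hsqrtπ]
  -- (2) the real part of `Λ τ − L`
  have hw_re : ∀ τ : ℝ, (w τ).re = 1 / 2 := fun τ ↦ by simp [hw]
  have hw_im : ∀ τ : ℝ, (w τ).im = τ := fun τ ↦ by simp [hw]
  have hS_re : ∀ τ : ℝ, (stirlingExp (w τ)).re =
      ((w τ).re - 1 / 2) * Real.log ‖w τ‖ - (w τ).im * Complex.arg (w τ) - (w τ).re +
        (1 / (12 * w τ)).re := by
    intro τ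
    rw [stirlingExp_def, add_re, sub_re, mul_re, Complex.log_re, Complex.log_im]
    simp
  have hS_im : ∀ τ : ℝ, (stirlingExp (w τ)).im =
      ((w τ).re - 1 / 2) * Complex.arg (w τ) + (w τ).im * Real.log ‖w τ‖ - (w τ).im +
        (1 / (12 * w τ)).im := by
    intro τ
    rw [stirlingExp_def, add_im, sub_im, mul_im, Complex.log_re, Complex.log_im]
    simp
  have hlogΓ : ∀ τ : ℝ, 0 ≤ τ → Real.log ‖Complex.Gamma (w τ)‖ = Real.log (Real.sqrt π) + (I * P τ).re := by
    intro τ hτ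
    rw [Gamma_half_add_mul_I hτ, norm_mul, Complex.norm_real, Real.norm_eq_abs,
      abs_of_pos hsqrtπ, Complex.norm_exp, Real.log_mul hsqrtπ.ne' (Real.exp_pos _).ne',
      Real.log_exp]
  have hre : ∀ τ : ℝ, 1 ≤ τ → |(Λ τ - L).re| ≤ (1 / 12 + π / 24 + 1 / 12) / τ := by
    intro τ hτ
    have hτ0 : 0 < τ := by linarith
    obtain ⟨hτx, -, -⟩ := mul_log_norm_half_sub_log_le hτ
    have hxpos : 0 < ‖w τ‖ := hτ0.trans_le hτx
    have hG := abs_log_norm_Gamma_sub_le (w := w τ) (by rw [hw_re]; norm_num)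
    have hid : (Λ τ - L).re =
        (Real.log ‖Complex.Gamma (w τ)‖ - (((w τ).re - 1 / 2) * Real.log ‖w τ‖ -
          (w τ).im * Complex.arg (w τ) - (w τ).re + Real.log (2 * π) / 2)) - (1 / (12 * w τ)).re := by
      rw [sub_re, hΛ]
      simp only [add_re, sub_re, Complex.ofReal_re]
      rw [hlogΓ τ hτ0.le, hS_re τ, hL, Complex.ofReal_re,
        Real.log_sqrt (by positivity : (0:ℝ) ≤ 2 * π)]
      ring
    rw [hid]
    have h2 : |(1 / (12 * w τ)).re| ≤ 1 / (12 * τ) := by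
      refine (Complex.abs_re_le_norm _).trans ?_
      rw [norm_div, norm_one, norm_mul, Complex.norm_ofNat]
      exact one_div_le_one_div_of_le (by positivity) (by nlinarith)
    have h1 : (1 / 12) * (1 / ‖w τ‖ ^ 2 + π / (2 * ‖w τ‖)) ≤ (1 / 12) * (1 / τ + π / (2 * τ)) := by
      refine mul_le_mul_of_nonneg_left (add_le_add ?_ ?_) (by norm_num)
      · calc 1 / ‖w τ‖ ^ 2 ≤ 1 / τ ^ 2 := one_div_le_one_div_of_le (by positivity) (by nlinarith)
          _ ≤ 1 / τ := by
              rw [div_le_div_iff₀ (by positivity) hτ0]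
              nlinarith
      · exact div_le_div_of_nonneg_left (by positivity) (by positivity) (by nlinarith)
    calc |Real.log ‖Complex.Gamma (w τ)‖ - (((w τ).re - 1 / 2) * Real.log ‖w τ‖ -
          (w τ).im * Complex.arg (w τ) - (w τ).re + Real.log (2 * π) / 2) - (1 / (12 * w τ)).re|
        ≤ |Real.log ‖Complex.Gamma (w τ)‖ - (((w τ).re - 1 / 2) * Real.log ‖w τ‖ -
          (w τ).im * Complex.arg (w τ) - (w τ).re + Real.log (2 * π) / 2)| + |(1 / (12 * w τ)).re| :=
          abs_sub _ _
      _ ≤ (1 / 12) * (1 / τ + π / (2 * τ)) + 1 / (12 * τ) := add_le_add (hG.trans h1) h2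
      _ = (1 / 12 + π / 24 + 1 / 12) / τ := by ring
  -- (3) the imaginary part of `Λ τ − L`
  have hPre : ∀ τ : ℝ, (P τ).re = argGammaVert (1 / 2) τ := by
    intro τ
    have hi : IntervalIntegrable (fun y : ℝ ↦ digamma (1 / 2 + y * I)) volume 0 τ :=
      continuous_digamma_half_line.intervalIntegrable _ _
    have h := Complex.reCLM.intervalIntegral_comp_comm hi
    simp only [Complex.reCLM_apply] at h
    rw [hP, ← h, argGammaVert]
    refine intervalIntegral.integral_congr fun y _ ↦ ?_
    congr 2
    push_cast
    ring
  have him : ∀ τ : ℝ, 1 ≤ τ → |(Λ τ - L).im| ≤ (K + 1 / 8 + 1 / 12) / τ := by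
    intro τ hτ
    have hτ0 : 0 < τ := by linarith
    obtain ⟨hτx, hl0, hl1⟩ := mul_log_norm_half_sub_log_le hτ
    have hA := abs_argGammaVert_sub_stirling_le (σ := 1 / 2) (by norm_num) hτ
    rw [stirlingArgConst_one_half, sub_zero] at hA
    have hid : (Λ τ - L).im =
        (argGammaVert (1 / 2) τ - (τ * Real.log τ - τ)) -
          τ * (Real.log ‖w τ‖ - Real.log τ) - (1 / (12 * w τ)).im := by
      rw [sub_im, hΛ]
      simp only [add_im, sub_im, Complex.ofReal_im, mul_im, Complex.I_re, Complex.I_im]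
      rw [hS_im τ, hPre τ, hL, Complex.ofReal_im, hw_re, hw_im]
      ring
    rw [hid]
    have h2 : |(1 / (12 * w τ)).im| ≤ 1 / (12 * τ) := by
      refine (Complex.abs_im_le_norm _).trans ?_
      rw [norm_div, norm_one, norm_mul, Complex.norm_ofNat]
      exact one_div_le_one_div_of_le (by positivity) (by nlinarith)
    have h3 : |τ * (Real.log ‖w τ‖ - Real.log τ)| ≤ 1 / (8 * τ) := by
      rw [abs_of_nonneg hl0]; exact hl1
    have e1 := abs_sub (argGammaVert (1 / 2) τ - (τ * Real.log τ - τ) -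
      τ * (Real.log ‖w τ‖ - Real.log τ)) ((1 / (12 * w τ)).im)
    have e2 := abs_sub (argGammaVert (1 / 2) τ - (τ * Real.log τ - τ))
      (τ * (Real.log ‖w τ‖ - Real.log τ))
    have e3 : K / τ + 1 / (8 * τ) + 1 / (12 * τ) = (K + 1 / 8 + 1 / 12) / τ := by ring
    linarith
  -- (4) `Λ τ → L`
  have hΛL : Tendsto Λ atTop (𝓝 L) := by
    refine tendsto_iff_norm_sub_tendsto_zero.2 ?_
    have hC0 : Tendsto (fun τ : ℝ ↦ C / τ) atTop (𝓝 0) := tendsto_const_nhds.div_atTop tendsto_id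
    refine squeeze_zero_norm' ?_ hC0
    filter_upwards [eventually_ge_atTop (1 : ℝ)] with τ hτ
    rw [norm_norm]
    calc ‖Λ τ - L‖ ≤ |(Λ τ - L).re| + |(Λ τ - L).im| := Complex.norm_le_abs_re_add_abs_im _
      _ ≤ (1 / 12 + π / 24 + 1 / 12) / τ + (K + 1 / 8 + 1 / 12) / τ := add_le_add (hre τ hτ) (him τ hτ)
      _ = C / τ := by rw [hC]; ring
  -- (5) conclusion
  have hexp : Tendsto (fun τ : ℝ ↦ Complex.exp (Λ τ)) atTop (𝓝 (Complex.exp L)) :=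
    (Complex.continuous_exp.tendsto L).comp hΛL
  have hexpL : Complex.exp L = (Real.sqrt (2 * π) : ℂ) := by
    rw [hL, ← Complex.ofReal_exp, Real.exp_log hsqrt2π]
  rw [hexpL] at hexp
  refine hexp.congr' ?_
  filter_upwards [eventually_ge_atTop (0 : ℝ)] with τ hτ
  exact (hQ τ hτ).symm

/-! ### The main theorem -/

/-- **Complex Stirling formula in the upper half-plane, with the first Binet term and an explicit
error**: for `Im z > 0` there is `E` with `|E| ≤ (π+1)/(16π (Im z)²)` (`< 0.0824/(Im z)²`) and

  `Γ(z) = √(2π) · exp((z − ½) Log z − z + 1/(12z) + E)`.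

Proof: `Q = Γ e^{−S}` is transported up the vertical ray from `z` by `exp(i∫ μ')` with
`‖μ'(z + iy)‖ ≤ (π+1)/(8π (Im z + y)³)` (`norm_digamma_sub_stirling_le_of_im_pos`), and
`Q(x + ih) → √(2π)` as `h → ∞` (horizontal comparison with the line `Re = ½` and
`tendsto_Gamma_mul_exp_neg_stirlingExp_half_line`). Textbook statement (Stirling's series with
Binet's/Stieltjes' remainder): Whittaker–Watson §12.33, §13.6; the `Im z`-form of the remainder is
ours (weaker constant than Boyd's, quoted in Polymath 15, Lemma 5.1 (v)).
[cite: WhittakerWatson1927, §12.33] [cite: Polymath2019, Lemma 5.1 (v)] -/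
theorem exists_Gamma_eq_exp_stirlingExp {z : ℂ} (hz : 0 < z.im) :
    ∃ E : ℂ, ‖E‖ ≤ (π + 1) / (16 * π * z.im ^ 2) ∧
      Complex.Gamma z = (Real.sqrt (2 * π) : ℂ) * Complex.exp (stirlingExp z + E) := by
  set u : ℝ := z.im with hu
  set f : ℝ → ℂ := fun y ↦ binetDeriv (z + y * I) with hf
  set B : ℝ := (π + 1) / (16 * π * z.im ^ 2) with hB
  have hfc : ContinuousOn f (Ici 0) := continuousOn_binetDeriv_vertical hz
  have hfi : ∀ n : ℕ, IntegrableOn f (Ioc 0 (n : ℝ)) := fun n ↦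
    ((hfc.mono Icc_subset_Ici_self).integrableOn_compact isCompact_Icc).mono_set Ioc_subset_Icc_self
  have hbound : ∀ n : ℕ, ∫ y in (0 : ℝ)..n, ‖f y‖ ≤ B := fun n ↦
    integral_norm_binetDeriv_vertical_le hz (Nat.cast_nonneg n)
  have hInt : IntegrableOn f (Ioi 0) :=
    integrableOn_Ioi_of_intervalIntegral_norm_bounded B 0 hfi tendsto_natCast_atTop_atTop
      (Eventually.of_forall hbound)
  set Lz : ℂ := ∫ y in Ioi 0, f y with hLz
  have hlim1 : Tendsto (fun Y : ℝ ↦ ∫ y in (0 : ℝ)..Y, f y) atTop (𝓝 Lz) :=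
    intervalIntegral_tendsto_integral_Ioi 0 hInt tendsto_id
  -- `‖Lz‖ ≤ B`
  have hLzB : ‖Lz‖ ≤ B := by
    refine le_of_tendsto ((continuous_norm.tendsto _).comp hlim1) ?_
    filter_upwards [eventually_ge_atTop (0 : ℝ)] with Y hY
    simp only [Function.comp_apply]
    exact (intervalIntegral.norm_integral_le_integral_norm hY).trans
      (integral_norm_binetDeriv_vertical_le hz hY)
  -- `Q(z + iY) → Q(z) exp(i Lz)`
  set Qz : ℂ := Complex.Gamma z * Complex.exp (-stirlingExp z) with hQz
  have hlim2 : Tendsto (fun Y : ℝ ↦ Complex.Gamma (z + Y * I) * Complex.exp (-stirlingExp (z + Y * I)))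
      atTop (𝓝 (Qz * Complex.exp (I * Lz))) := by
    have h1 : Tendsto (fun Y : ℝ ↦ Qz * Complex.exp (I * ∫ y in (0 : ℝ)..Y, f y)) atTop
        (𝓝 (Qz * Complex.exp (I * Lz))) :=
      tendsto_const_nhds.mul ((Complex.continuous_exp.tendsto _).comp (hlim1.const_mul I))
    refine h1.congr' ?_
    filter_upwards [eventually_ge_atTop (0 : ℝ)] with Y hY
    exact (Gamma_mul_exp_neg_stirlingExp_vertical hz hY).symm
  -- `Q(z + iY) → √(2π)` by horizontal comparison with the line `Re = ½`
  set d : ℂ := ((z.re - 1 / 2 : ℝ) : ℂ) with hd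
  have hlim3 : Tendsto (fun Y : ℝ ↦ Complex.Gamma (z + Y * I) * Complex.exp (-stirlingExp (z + Y * I)))
      atTop (𝓝 (Real.sqrt (2 * π) : ℂ)) := by
    have hrepr : ∀ Y : ℝ, 0 ≤ Y →
        Complex.Gamma (z + Y * I) * Complex.exp (-stirlingExp (z + Y * I)) =
          (Complex.Gamma (1 / 2 + ((u + Y : ℝ) : ℂ) * I) *
              Complex.exp (-stirlingExp (1 / 2 + ((u + Y : ℝ) : ℂ) * I))) *
            Complex.exp (∫ τ in (0 : ℝ)..1,
              binetDeriv (1 / 2 + ((u + Y : ℝ) : ℂ) * I + τ * d) * d) := by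
      intro Y hY
      have hU : ∀ τ ∈ Icc (0 : ℝ) 1, (1 / 2 + ((u + Y : ℝ) : ℂ) * I) + τ * d ∈ slitPlane := by
        intro τ _
        right
        have : 0 < u + Y := by positivity
        simp [hd]
        exact this.ne'
      have h := Gamma_mul_exp_neg_stirlingExp_seg hU
      have e : (1 / 2 + ((u + Y : ℝ) : ℂ) * I) + d = z + Y * I := by
        apply Complex.ext
        · simp [hd]
        · simp [hd, hu]
      rw [e] at h
      exact h
    have hN : Tendsto (fun Y : ℝ ↦ Complex.Gamma (1 / 2 + ((u + Y : ℝ) : ℂ) * I) *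
        Complex.exp (-stirlingExp (1 / 2 + ((u + Y : ℝ) : ℂ) * I))) atTop
        (𝓝 (Real.sqrt (2 * π) : ℂ)) := by
      have ht : Tendsto (fun Y : ℝ ↦ u + Y) atTop atTop := tendsto_atTop_add_const_left _ u tendsto_id
      exact tendsto_Gamma_mul_exp_neg_stirlingExp_half_line.comp ht
    have hH : Tendsto (fun Y : ℝ ↦ ∫ τ in (0 : ℝ)..1,
        binetDeriv (1 / 2 + ((u + Y : ℝ) : ℂ) * I + τ * d) * d) atTop (𝓝 0) := by
      have hg : Tendsto (fun Y : ℝ ↦ (π + 1) / (8 * π) * ((u + Y) ^ 3)⁻¹ * ‖d‖) atTop (𝓝 0) := by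
        have h1 : Tendsto (fun Y : ℝ ↦ (u + Y) ^ 3) atTop atTop :=
          (tendsto_pow_atTop (by norm_num : (3 : ℕ) ≠ 0)).comp
            (tendsto_atTop_add_const_left _ u tendsto_id)
        have h2 := h1.inv_tendsto_atTop
        have := (h2.const_mul ((π + 1) / (8 * π))).mul_const ‖d‖
        simpa using this
      refine squeeze_zero_norm' ?_ hg
      filter_upwards [eventually_ge_atTop (0 : ℝ)] with Y hY
      have hY' : 0 < u + Y := by positivity
      have hle : ‖∫ τ in (0 : ℝ)..1, binetDeriv (1 / 2 + ((u + Y : ℝ) : ℂ) * I + τ * d) * d‖ ≤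
          (π + 1) / (8 * π) * ((u + Y) ^ 3)⁻¹ * ‖d‖ * |1 - 0| := by
        refine intervalIntegral.norm_integral_le_of_norm_le_const fun τ _ ↦ ?_
        rw [norm_mul]
        refine mul_le_mul_of_nonneg_right ?_ (norm_nonneg _)
        have him : (1 / 2 + ((u + Y : ℝ) : ℂ) * I + τ * d).im = u + Y := by simp [hd]
        have h := norm_binetDeriv_le (w := 1 / 2 + ((u + Y : ℝ) : ℂ) * I + τ * d)
          (by rw [him]; exact hY')
        rw [him] at h
        refine h.trans (le_of_eq ?_)
        field_simp
      simpa using hle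
    have hprod := hN.mul ((Complex.continuous_exp.tendsto 0).comp hH)
    rw [Complex.exp_zero, mul_one] at hprod
    refine hprod.congr' ?_
    filter_upwards [eventually_ge_atTop (0 : ℝ)] with Y hY
    exact (hrepr Y hY).symm
  -- uniqueness of limits and conclusion
  have hEq : Qz * Complex.exp (I * Lz) = (Real.sqrt (2 * π) : ℂ) := tendsto_nhds_unique hlim2 hlim3
  refine ⟨-(I * Lz), ?_, ?_⟩
  · rw [norm_neg, norm_mul, Complex.norm_I, one_mul]
    exact hLzB
  · calc Complex.Gamma z = Qz * Complex.exp (I * Lz) * Complex.exp (stirlingExp z + -(I * Lz)) := by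
          rw [hQz, mul_assoc, mul_assoc, ← Complex.exp_add, ← Complex.exp_add]
          have : -stirlingExp z + (I * Lz + (stirlingExp z + -(I * Lz))) = 0 := by ring
          rw [this, Complex.exp_zero, mul_one]
      _ = (Real.sqrt (2 * π) : ℂ) * Complex.exp (stirlingExp z + -(I * Lz)) := by rw [hEq]

/-- **Complex Stirling formula in the upper half-plane** (the form of Polymath 15, Lemma 5.1 (v), with
the remainder measured by `Im z`): for `Im z > 0` there is `E` with
`|E| ≤ 1/(12|z|) + (π+1)/(16π (Im z)²)` and `Γ(z) = √(2π) exp((z − ½) Log z − z + E)`.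
[cite: WhittakerWatson1927, §12.33] [cite: Polymath2019, Lemma 5.1 (v)] -/
theorem exists_Gamma_eq_exp_stirling {z : ℂ} (hz : 0 < z.im) :
    ∃ E : ℂ, ‖E‖ ≤ 1 / (12 * ‖z‖) + (π + 1) / (16 * π * z.im ^ 2) ∧
      Complex.Gamma z = (Real.sqrt (2 * π) : ℂ) * Complex.exp ((z - 1 / 2) * Complex.log z - z + E) := by
  obtain ⟨E, hE, hΓ⟩ := exists_Gamma_eq_exp_stirlingExp hz
  have hz0 : z ≠ 0 := fun h ↦ by rw [h] at hz; simp at hz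
  refine ⟨1 / (12 * z) + E, ?_, ?_⟩
  · refine (norm_add_le _ _).trans (add_le_add (le_of_eq ?_) hE)
    rw [norm_div, norm_one, norm_mul, Complex.norm_ofNat]
  · rw [hΓ, stirlingExp_def]
    congr 1
    ring_nf

/-- **Lemma 5.1 (v)-type packaging**: for `Im z > 1`,
`Γ(z) = √(2π) exp((z − ½) Log z − z + O_≤(1/(12 (Im z − 1))))` (Polymath 15 prints
`O_≤(1/(12(|z| − 0.33)))` on `|Im z| ≥ 1 ∨ Re z ≥ 1`, after Boyd 1994; the present constant comes
from `1/(12 Im z) + 0.0824/(Im z)² ≤ 1/(12(Im z − 1))`; weaker than the printed constant, and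
stated for `Im z > 1` only). [cite: Polymath2019, Lemma 5.1 (v)] [cite: WhittakerWatson1927, §12.33] -/
theorem exists_Gamma_eq_exp_stirling_of_one_lt_im {z : ℂ} (hz : 1 < z.im) :
    ∃ E : ℂ, ‖E‖ ≤ 1 / (12 * (z.im - 1)) ∧
      Complex.Gamma z = (Real.sqrt (2 * π) : ℂ) * Complex.exp ((z - 1 / 2) * Complex.log z - z + E) := by
  have hz0 : 0 < z.im := by linarith
  obtain ⟨E, hE, hΓ⟩ := exists_Gamma_eq_exp_stirling hz0
  refine ⟨E, hE.trans ?_, hΓ⟩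
  have hu : z.im ≤ ‖z‖ := le_trans (le_abs_self _) (Complex.abs_im_le_norm z)
  have h1 : 1 / (12 * ‖z‖) ≤ 1 / (12 * z.im) :=
    one_div_le_one_div_of_le (by positivity) (by linarith)
  refine (add_le_add h1 le_rfl).trans ?_
  -- `1/(12u) + κ/u² ≤ 1/(12(u−1))` with `κ = (π+1)/(16π) < 1/12`
  have hκ : (π + 1) / (16 * π) ≤ 1 / 12 := by
    rw [div_le_div_iff₀ (by positivity) (by norm_num)]
    have := Real.pi_gt_three
    nlinarith
  set u := z.im with hu'
  have hu1 : 0 < u - 1 := by linarith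
  have key : 1 / (12 * u) + 1 / 12 / u ^ 2 ≤ 1 / (12 * (u - 1)) := by
    rw [div_add_div _ _ (by positivity) (by positivity), div_le_div_iff₀ (by positivity) (by positivity)]
    nlinarith
  have h2 : (π + 1) / (16 * π * u ^ 2) ≤ 1 / 12 / u ^ 2 := by
    rw [show (π + 1) / (16 * π * u ^ 2) = (π + 1) / (16 * π) / u ^ 2 by field_simp]
    exact div_le_div_of_nonneg_right hκ (by positivity)
  linarith

end Literature.Analysis.SpecialFunctions.GammaStirling

end
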